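import Mathlib
import Summits.Ventures.PercRepro2.CoinChainXAHullSix
import Summits.Ventures.PercRepro2.CoinChainXAMMinusThree
import Summits.Ventures.PercRepro2.CoinChainXAMGateAlg
import Summits.Ventures.PercRepro2.CoinChainXAMjGateAlg
import Summits.Ventures.PercRepro2.CoinChainXAMjpGate
import Summits.Ventures.PercRepro2.CoinChainXAClosedGateAlg

/-!
# EVERY M-supported gate reduces to the sixth corner (M⁻) — the parts theorems
(blind cell PercRepro2, night-2 g31; proofs/NIGHT2-DARC.md §73.6)

For `ent = {m}`, ANY `ent' ∋ j, j'` and the entry markers, an M-supported gate enters the (XA′) functional only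
through its four cell masses `(r₀, rₓ, r_y, ω)` on the unmarked / `x`-only / `y`-only / `xy` sure-entered clusters
(`cg_mgate_decomp`: the functional is AFFINE in them), and the cell-level Ahlswede–Daykin facts say: the gate ratio
is increasing (`r₀·b₁ ≤ rₓ·b`, `r₀·b₂ ≤ r_y·b`, `rₓ·b₁₂ ≤ ω·b₁`, `r_y·b₁₂ ≤ ω·b₂`, `ω ≤ b₁₂`) and the gate law is
log-supermodular (`rₓ·r_y ≤ r₀·ω`) — the hypotheses of `hull_six_mass`.  Five of the six corners are theorems for
every `ent'` (closed `cg_parts`, top `cg_top_full`, `mj` / `mj'` `cg_mj_full` and its mirror, `m` `cg_m_full`);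
so EVERY M-SUPPORTED GATE REDUCES TO THE SIXTH CORNER (M⁻), the polynomial inequality
`XYM·T_open + α·(XM − XYM)·(YM − XYM) ≥ 0` in the BASE parts (the both-open corner `(x2, y2)` of §72.13 at
`ω = XYM`, `r∅ = rₓ·r_y/ω`): `mgate_of_mminus`.  For two coin entries (`δ = XJ + YJ − XYJ`, no unmarked killed
mass) (M⁻) is the theorem `cg_mminus_three`, giving `mgate_three_parts` — a second proof, by the six-corner hull,
of the M-supported case of g29's `chain_XA'_jp` (§71); for three or more coin entries (M⁻) is the single
open inequality of the M-gate (§73.6).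
-/

namespace Summit.Ventures.PercRepro2.Coin

section MGateOfMMinus

variable {R : Type*} [Field R] [LinearOrder R] [IsStrictOrderedRing R]

set_option maxHeartbeats 4000000 in
/-- **EVERY M-SUPPORTED GATE REDUCES TO THE SIXTH CORNER (M⁻)** (parts form, any entry structure with
`ent = {m}`): under the facts of the five known corners, the gate's cell facts and the (M⁻) inequality `HMM`
in the base parts, the (XA′) functional `HP` of `cg_mgate_decomp` is nonnegative. -/
theorem mgate_of_mminus (a δ u t XJ XU XM YJ YU YM XYM r0 rx ry ω : R)
    (ha : 0 ≤ a) (hδ0 : 0 ≤ δ) (hu : 0 ≤ u) (ht : 0 ≤ t) (hXJ : 0 ≤ XJ) (hXU : 0 ≤ XU) (hXM : 0 ≤ XM)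
    (hYJ : 0 ≤ YJ) (hYU : 0 ≤ YU) (hYM : 0 ≤ YM) (hXYM : 0 ≤ XYM)
    (hJUx : 0 ≤ XU * (a + δ) - XJ * u) (hJMx : 0 ≤ XM * (a + δ) - XJ * t)
    (hMcMx : 0 ≤ XM * (a + δ + u) - (XJ + XU) * t)
    (hJUy : 0 ≤ YU * (a + δ) - YJ * u) (hJMy : 0 ≤ YM * (a + δ) - YJ * t)
    (hMcMy : 0 ≤ YM * (a + δ + u) - (YJ + YU) * t)
    (hMcM2 : 0 ≤ XYM * (a + δ + u) - (YJ + YU) * XM) (hMcM2' : 0 ≤ XYM * (a + δ + u) - (XJ + XU) * YM)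
    (hBx : 0 ≤ XM * (a + u) - XU * t) (hBy : 0 ≤ YM * (a + u) - YU * t)
    (hBB2 : 0 ≤ XYM * (a + u) - YU * XM) (hBB2' : 0 ≤ XYM * (a + u) - XU * YM)
    (hMM : 0 ≤ XYM * t - XM * YM)
    (hIMx : 0 ≤ (a + δ - XJ) * XYM - XJ * (YM - XYM)) (hIMy : 0 ≤ (a + δ - YJ) * XYM - YJ * (XM - XYM))
    (hXJδ : 0 ≤ δ - XJ) (hXUu : 0 ≤ u - XU) (hXMt : 0 ≤ t - XM) (hYJδ : 0 ≤ δ - YJ)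
    (hYUu : 0 ≤ u - YU) (hYMt : 0 ≤ t - YM) (hXYMx : 0 ≤ XM - XYM) (hXYMy : 0 ≤ YM - XYM)
    (HMM : 0 ≤ XYM * ((a * (a + δ + u + t) * (XJ + XU + XM) * (YJ + YU + YM) - (XJ * (a + δ + u + t) - δ * (XJ + XU + XM)) * (YM * (a + δ + u + t) - t * (YJ + YU + YM)) - (YJ * (a + δ + u + t) - δ * (YJ + YU + YM)) * (XM * (a + δ + u + t) - t * (XJ + XU + XM))) + ((a + δ + u + t) * ((a + δ + u + t) - (XJ + XU + XM)) * ((a + δ + u + t) - (YJ + YU + YM)) + (XJ * (a + δ + u + t) - δ * (XJ + XU + XM)) * ((a + δ + u + t) - (YJ + YU + YM)) + (YJ * (a + δ + u + t) - δ * (YJ + YU + YM)) * ((a + δ + u + t) - (XJ + XU + XM))) * XYM + (-(((a + δ + u + t) * (a + δ + u + t) * (YJ + YU + YM) + (a + δ + u + t) * ((a + δ + u + t) * (YU + YM) - (YJ + YU + YM) * (a + u + t))) - ((a + δ + u + t) * (XJ + XU + XM) * (YJ + YU + YM) + ((a + δ + u + t) * (XU + XM) - (XJ + XU + XM) * (a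 + u + t)) * (YJ + YU + YM) + ((a + δ + u + t) * (YU + YM) - (YJ + YU + YM) * (a + u + t)) * (XJ + XU + XM)))) * (XM - XYM) + (-(((a + δ + u + t) * (a + δ + u + t) * (XJ + XU + XM) + (a + δ + u + t) * ((a + δ + u + t) * (XU + XM) - (XJ + XU + XM) * (a + u + t))) - ((a + δ + u + t) * (XJ + XU + XM) * (YJ + YU + YM) + ((a + δ + u + t) * (XU + XM) - (XJ + XU + XM) * (a + u + t)) * (YJ + YU + YM) + ((a + δ + u + t) * (YU + YM) - (YJ + YU + YM) * (a + u + t)) * (XJ + XU + XM)))) * (YM - XYM)) + ((a + δ + u + t) * (XJ + XU + XM) * (YJ + YU + YM) + ((a + δ + u + t) * (XU + XM) - (XJ + XU + XM) * (a + u + t)) * (YJ + YU + YM) + ((a + δ + u + t) * (YU + YM) - (YJ + YU + YM) * (a + u + t)) * (XJ + XU + XM)) * ((XM - XYM) * (YM - XYM)))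
    (hbpos : 0 < t - XM - YM + XYM) (hb1pos : 0 < XM - XYM) (hb2pos : 0 < YM - XYM) (hb12pos : 0 < XYM)
    (hr0 : 0 ≤ r0) (h0x : r0 * (XM - XYM) ≤ rx * (t - XM - YM + XYM))
    (h0y : r0 * (YM - XYM) ≤ ry * (t - XM - YM + XYM))
    (hx : rx * XYM ≤ ω * (XM - XYM)) (hy : ry * XYM ≤ ω * (YM - XYM)) (hω : ω ≤ XYM)
    (hlsm : rx * ry ≤ r0 * ω) :
    0 ≤ (a + δ + u + t) * ((a + δ + u + t) * (a + δ + u + t) * ω - (a + δ + u + t) * (YJ + YU + YM) * (ω + rx) - (a + δ + u + t) * (XJ + XU + XM) * (ω + ry) + (XJ + XU + XM) * (YJ + YU + YM) * (a + (ω + rx + ry + r0))) - (((a + δ + u + t) * (XU + XM) - (XJ + XU + XM) * (a + u + t)) * ((a + δ + u + t) * (YJ + YU + (ω + ry)) - (YJ + YU + YM) * (a + δ + u + (ω + rx + ry + r0))) + ((a + δ + u + t) * (YU + YM) - (YJ + YU + YM) * (a + u + t)) * ((a + δ + u + t) * (XJ + XU + (ω + rx)) - (XJ + XU + XM) * (a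 + δ + u + (ω + rx + ry + r0)))) := by
  have hΛ : (XM - XYM) * (YM - XYM) ≤ (t - XM - YM + XYM) * XYM := by linear_combination hMM
  have Hc := cg_parts a δ u t XJ XU XM YJ YU YM ha hu ht hXJ hXU hXM hYJ hYU hYM hJUx hJMx hMcMx hJUy hJMy hMcMy hXJδ hXUu hXMt
  have Ht := cg_top_full a δ u t XJ XU XM YJ YU YM XYM ha hδ0 hu ht hXJ hXU hXM hYJ hYU hYM hXYM hJUx hJMx hMcMx hJUy hMcMy hIMx hIMy hBx hBy hXJδ hXUu hXMt hYJδ hYUu hYMt hXYMx hXYMy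
  have Hmj := cg_mj_full a δ u t XJ XU XM YJ YU YM XYM ha hδ0 hu ht hXJ hXU hXM hYJ hYU hYM hXYM hJUx hJMx hMcMx hJUy hMcMy hMcM2 hBx hBy hBB2 hMM hXUu hXMt hYMt hXYMx
  have hMM' : 0 ≤ XYM * t - YM * XM := by linear_combination hMM
  have Hmjp := cg_mj_full a δ u t YJ YU YM XJ XU XM XYM ha hδ0 hu ht hYJ hYU hYM hXJ hXU hXM hXYM hJUy hJMy hMcMy hJUx hMcMx hMcM2' hBy hBx hBB2' hMM' hYUu hYMt hXMt hXYMy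
  have Hm := cg_m_full a δ u t XJ XU XM YJ YU YM XYM ha hδ0 hu ht hXJ hXU hXM hYJ hYU hYM hMcMx hMcMy hXYM hMM hXMt hYMt hXYMx
  have hull := hull_six_mass (a * (a + δ + u + t) * (XJ + XU + XM) * (YJ + YU + YM) - (XJ * (a + δ + u + t) - δ * (XJ + XU + XM)) * (YM * (a + δ + u + t) - t * (YJ + YU + YM)) - (YJ * (a + δ + u + t) - δ * (YJ + YU + YM)) * (XM * (a + δ + u + t) - t * (XJ + XU + XM))) ((a + δ + u + t) * (XJ + XU + XM) * (YJ + YU + YM) + ((a + δ + u + t) * (XU + XM) - (XJ + XU + XM) * (a + u + t)) * (YJ + YU + YM) + ((a + δ + u + t) * (YU + YM) - (YJ + YU + YM) * (a + u + t)) * (XJ + XU + XM)) (-(((a + δ + u + t) * (a + δ + u + t) * (YJ + YU + YM) + (a + δ + u + t) * ((a + δ + u + t) * (YU + YM) - (YJ + YU + YM) * (a + u + t))) - ((a + δ + u + t) * (XJ + XU + XM) * (YJ + YU + YM) + ((a + δ + u + t) * (XU + XM) - (XJ + XU + XM) * (a + u + t)) * (YJ + YU + YM) + ((a + δ + u + t)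 * (YU + YM) - (YJ + YU + YM) * (a + u + t)) * (XJ + XU + XM)))) (-(((a + δ + u + t) * (a + δ + u + t) * (XJ + XU + XM) + (a + δ + u + t) * ((a + δ + u + t) * (XU + XM) - (XJ + XU + XM) * (a + u + t))) - ((a + δ + u + t) * (XJ + XU + XM) * (YJ + YU + YM) + ((a + δ + u + t) * (XU + XM) - (XJ + XU + XM) * (a + u + t)) * (YJ + YU + YM) + ((a + δ + u + t) * (YU + YM) - (YJ + YU + YM) * (a + u + t)) * (XJ + XU + XM)))) ((a + δ + u + t) * ((a + δ + u + t) - (XJ + XU + XM)) * ((a + δ + u + t) - (YJ + YU + YM)) + (XJ * (a + δ + u + t) - δ * (XJ + XU + XM)) * ((a + δ + u + t) - (YJ + YU + YM)) + (YJ * (a + δ + u + t) - δ * (YJ + YU + YM)) * ((a + δ + u + t) - (XJ + XU + XM))) (t - XM - YM + XYM) (XM - XYM) (YM - XYM) XYM r0 rx ry ω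
    hbpos hb1pos hb2pos hb12pos hΛ hr0 h0x h0y hx hy hω hlsm
    (by linear_combination Hc) (by linear_combination Ht) (by linear_combination Hmj) (by linear_combination Hmjp)
    (by linear_combination HMM) (by linear_combination Hm)
  rw [cg_mgate_decomp]
  linear_combination hull

/-- **EVERY M-SUPPORTED GATE OF THE TWO-COIN CHAIN** (parts form, `δ = XJ + YJ − XYJ`): (M⁻) is the theorem
`cg_mminus_three`, so `mgate_of_mminus` closes every gate — the six-corner proof of the M-supported case of §71. -/
theorem mgate_three_parts (a δ u t XJ XU XM YJ YU YM XYM XYJ r0 rx ry ω : R) (hδ : δ = XJ + YJ - XYJ)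
    (ha : 0 ≤ a) (hδ0 : 0 ≤ δ) (hu : 0 ≤ u) (ht : 0 ≤ t) (hXJ : 0 ≤ XJ) (hXU : 0 ≤ XU) (hXM : 0 ≤ XM)
    (hYJ : 0 ≤ YJ) (hYU : 0 ≤ YU) (hYM : 0 ≤ YM) (hXYM : 0 ≤ XYM) (hXYJ : 0 ≤ XYJ)
    (hJUx : 0 ≤ XU * (a + δ) - XJ * u) (hJMx : 0 ≤ XM * (a + δ) - XJ * t)
    (hMcMx : 0 ≤ XM * (a + δ + u) - (XJ + XU) * t)
    (hJUy : 0 ≤ YU * (a + δ) - YJ * u) (hJMy : 0 ≤ YM * (a + δ) - YJ * t)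
    (hMcMy : 0 ≤ YM * (a + δ + u) - (YJ + YU) * t)
    (hMcM2 : 0 ≤ XYM * (a + δ + u) - (YJ + YU) * XM) (hMcM2' : 0 ≤ XYM * (a + δ + u) - (XJ + XU) * YM)
    (hBx : 0 ≤ XM * (a + u) - XU * t) (hBy : 0 ≤ YM * (a + u) - YU * t)
    (hBB2 : 0 ≤ XYM * (a + u) - YU * XM) (hBB2' : 0 ≤ XYM * (a + u) - XU * YM)
    (hMM : 0 ≤ XYM * t - XM * YM)
    (hIMx : 0 ≤ (a + δ - XJ) * XYM - XJ * (YM - XYM)) (hIMy : 0 ≤ (a + δ - YJ) * XYM - YJ * (XM - XYM))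
    (hXJδ : 0 ≤ δ - XJ) (hXUu : 0 ≤ u - XU) (hXMt : 0 ≤ t - XM) (hYJδ : 0 ≤ δ - YJ)
    (hYUu : 0 ≤ u - YU) (hYMt : 0 ≤ t - YM) (hXYMx : 0 ≤ XM - XYM) (hXYMy : 0 ≤ YM - XYM)
    (hK1 : 0 ≤ XJ - XYJ) (hK2 : 0 ≤ YJ - XYJ)
    (hK1b : 0 ≤ a * (XM - XYM) - (XJ - XYJ) * (t - XM - YM + XYM))
    (hK2b : 0 ≤ a * (YM - XYM) - (YJ - XYJ) * (t - XM - YM + XYM))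
    (hbpos : 0 < t - XM - YM + XYM) (hb1pos : 0 < XM - XYM) (hb2pos : 0 < YM - XYM) (hb12pos : 0 < XYM)
    (hr0 : 0 ≤ r0) (h0x : r0 * (XM - XYM) ≤ rx * (t - XM - YM + XYM))
    (h0y : r0 * (YM - XYM) ≤ ry * (t - XM - YM + XYM))
    (hx : rx * XYM ≤ ω * (XM - XYM)) (hy : ry * XYM ≤ ω * (YM - XYM)) (hω : ω ≤ XYM)
    (hlsm : rx * ry ≤ r0 * ω) :
    0 ≤ (a + δ + u + t) * ((a + δ + u + t) * (a + δ + u + t) * ω - (a + δ + u + t) * (YJ + YU + YM) * (ω + rx) - (a + δ + u + t) * (XJ + XU + XM) * (ω + ry) + (XJ + XU + XM) * (YJ + YU + YM) * (a + (ω + rx + ry + r0))) - (((a + δ + u + t) * (XU + XM) - (XJ + XU + XM) * (a + u + t)) * ((a + δ + u + t) * (YJ + YU + (ω + ry)) - (YJ + YU + YM) * (a + δ + u + (ω + rx + ry + r0))) + ((a + δ + u + t) * (YU + YM) - (YJ + YU + YM) * (a + u + t)) * ((a + δ + u + t) * (XJ + XU + (ω + rx)) - (XJ + XU + XM) * (a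 + δ + u + (ω + rx + ry + r0)))) :=
  mgate_of_mminus a δ u t XJ XU XM YJ YU YM XYM r0 rx ry ω ha hδ0 hu ht hXJ hXU hXM hYJ hYU hYM hXYM
    hJUx hJMx hMcMx hJUy hJMy hMcMy hMcM2 hMcM2' hBx hBy hBB2 hBB2' hMM hIMx hIMy hXJδ hXUu hXMt hYJδ hYUu hYMt hXYMx hXYMy
    (cg_mminus_three a δ u t XJ XU XM YJ YU YM XYM XYJ hδ ha hu ht hXJ hXU hXM hYJ hYU hYM hXYM hXYJ hK1 hK2
      hbpos.le hXYMx hXYMy hXUu hYUu hMcMx hMcMy hMM hK1b hK2b)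
    hbpos hb1pos hb2pos hb12pos hr0 h0x h0y hx hy hω hlsm

end MGateOfMMinus

end Summit.Ventures.PercRepro2.Coin
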